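import Mathlib.Order.PiLex
import Mathlib.Data.Prod.Lex
import Mathlib.Data.Fintype.Lattice
import Mathlib.Data.Finite.Prod
import Mathlib.Logic.Equiv.Basic
import Mathlib.GroupTheory.Perm.Basic
import HarnessLib

/-!
# Row and column lex-leader chains («double-lex») — the concrete form of the EXTSYM lemma

Cell `pub-hsemireg`, widening group W5, seat w5-n7-1 (gen 11); files of record
`widen/W5/N7-FEASIBILITY-w5n7.md` §3.16 (b) and the referee memo `widen/W5/EXTSYM-SOUNDNESS-w5n7g6.md` §2
(LEMMA 1 and its COROLLARY: csknsat's row/column constraints on the torus matrices of a pair are lex-leader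
constraints under ONE row-major order of the variables — the «double-lex» compatibility of
Flener–Frisch–Hnich–Kiziltan–Miguel–Pearson–Walsh, CP 2002). HONEST FRAMING: pure finite order theory.
Assignments are `X : ι → α` on a linearly ordered index set, compared lexicographically (`Pi.Lex`, first
variable most significant); a permutation `σ` acts by relabelling `X ↦ X ∘ σ`; the lex-leader constraint of
`σ` is `toLex (X ∘ σ) ≤ toLex X`. Self-contained (imports Mathlib + HarnessLib only). What is kernel-checked:

* `lexLeader_iff_chain` — for an INVOLUTION `σ` and any strictly increasing `φ` whose range contains the
  upper moved positions (`k < σ k`), the lex-leader constraint of `σ` on all variables is equivalent to the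
  chain comparison `(X (σ (φ c)))_c ≤_lex (X (φ c))_c`.
* `lexLeader_rowSwap_iff` — on a matrix of variables `X : R ×ₗ C → α` in ROW-MAJOR order, the lex-leader
  constraint of the transposition of rows `i₁ < i₂` is «row `i₂` ≤_lex row `i₁`».
* `lexLeader_colSwap_iff` — under the SAME row-major order, the lex-leader constraint of the transposition
  of columns `j₁ < j₂` is «column `j₂` ≤_lex column `j₁`» (columns read top-down).
* `exists_model_rows_cols_antitone` — DOUBLE-LEX IS SOUND: a satisfiable constraint on finite matrices that
  is invariant under swapping two rows and under swapping two columns has a model whose rows are lex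
  non-increasing downward AND whose columns are lex non-increasing rightward (the lex-maximal model).

In the W5 encoder (N7F §3.10 PS-1) the matrix of a pair `(i, j)` of coordinates has the levels of `i` as
rows and the levels of `j` as columns; equal-margin levels of coordinate 0 are ordered by their rows in the
pair `(0,1)`, those of coordinate `j ≥ 1` by their columns in `(0, j)` — first segments of the EXTSYM chains.
NOT formalised: the encoder, its CNF, any solver output. Nothing here is a statement about a variety, a
sheaf or a Hodge class, and nothing here bears on HC / HC_CM / HC_AV.
-/

namespace Summit.Ventures.HSemireg.LexLeaderRowColumn

variable {ι : Type*} [LinearOrder ι] {α : Type*} [LinearOrder α]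

/-- **Chain form of the lex-leader constraint of an involution.** Let `σ` be an involution of the ordered
variable set and `φ : κ → ι` a strictly increasing map whose range contains every UPPER moved position
(`k < σ k`) — e.g. their increasing enumeration; extra positions in the range are harmless (a fixed point
contributes a tied entry, a lower moved position repeats an earlier pair reversed, after that pair has
already decided or tied). Then `toLex (X ∘ σ) ≤ toLex X` iff the chain `(X (σ (φ c)))_c` is
lexicographically `≤` the chain `(X (φ c))_c`. (Memo §2 LEMMA 1: walk the variables in order; the first
difference between `X ∘ σ` and `X` sits at an upper moved position, where the constraint demands `X` wins.) -/
theorem lexLeader_iff_chain {κ : Type*} [LinearOrder κ] {σ : Equiv.Perm ι} (hσ : ∀ k, σ (σ k) = k)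
    {φ : κ → ι} (hφ : StrictMono φ) (hsurj : ∀ k, k < σ k → ∃ c, φ c = k) (X : ι → α) :
    toLex (X ∘ ⇑σ) ≤ toLex X ↔ toLex (fun c => X (σ (φ c))) ≤ toLex (fun c => X (φ c)) := by
  -- agreement at the upper moved positions below `i` propagates to all positions below `i`
  have propagate : ∀ i, (∀ j < i, j < σ j → X (σ j) = X j) → ∀ j < i, X (σ j) = X j := by
    intro i h j hj
    rcases lt_trichotomy j (σ j) with hlt | heq | hgt
    · exact h j hj hlt
    · rw [← heq]
    · have h' := h (σ j) (hgt.trans hj) (by rwa [hσ])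
      rw [hσ] at h'
      exact h'.symm
  -- the strict parts correspond
  have hlt : toLex (X ∘ ⇑σ) < toLex X ↔ toLex (fun c => X (σ (φ c))) < toLex (fun c => X (φ c)) := by
    constructor
    · rintro ⟨i, hi, hX⟩
      have hi' : ∀ j < i, X (σ j) = X j := fun j hj => hi j hj
      have hiup : i < σ i := by
        rcases lt_trichotomy i (σ i) with h | h | h
        · exact h
        · exact absurd (show X (σ i) = X i by rw [← h]) (ne_of_lt hX)
        · have h' := hi' (σ i) h
          rw [hσ] at h'
          exact absurd h'.symm (ne_of_lt hX)
      obtain ⟨c, rfl⟩ := hsurj i hiup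
      exact ⟨c, fun c' hc' => hi' (φ c') (hφ hc'), hX⟩
    · rintro ⟨c, hc, hX⟩
      refine ⟨φ c, propagate (φ c) (fun j hj hjup => ?_), hX⟩
      obtain ⟨c', rfl⟩ := hsurj j hjup
      exact hc c' (hφ.lt_iff_lt.1 hj)
  -- the equality parts correspond
  have heq : X ∘ ⇑σ = X ↔ (fun c => X (σ (φ c))) = fun c => X (φ c) := by
    constructor
    · intro h
      funext c
      exact congrFun h (φ c)
    · intro h
      funext j
      rw [Function.comp_apply]
      have hupper : ∀ k, k < σ k → X (σ k) = X k := fun k hk => by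
        obtain ⟨c, rfl⟩ := hsurj k hk
        exact congrFun h c
      rcases lt_trichotomy j (σ j) with hj | hj | hj
      · exact hupper j hj
      · rw [← hj]
      · have h' := hupper (σ j) (by rwa [hσ])
        rw [hσ] at h'
        exact h'.symm
  rw [le_iff_lt_or_eq, le_iff_lt_or_eq, hlt, toLex_inj, toLex_inj, heq]

section Matrix

variable {R C : Type*} [LinearOrder R] [LinearOrder C]

/-- **Row chains.** On a matrix of variables `X : R ×ₗ C → α` read in ROW-MAJOR order (`Prod.Lex`: first by
row, then by column), let `σ` be the transposition of the rows `i₁ < i₂`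
(`σ (r, c) = (swap i₁ i₂ r, c)`). Its lex-leader constraint `toLex (X ∘ σ) ≤ toLex X` is equivalent to
«row `i₂` ≤_lex row `i₁`» (rows read left to right). -/
theorem lexLeader_rowSwap_iff {i₁ i₂ : R} (hi : i₁ < i₂) {σ : Equiv.Perm (R ×ₗ C)}
    (hσ : ∀ r c, σ (toLex (r, c)) = toLex (Equiv.swap i₁ i₂ r, c)) (X : R ×ₗ C → α) :
    toLex (X ∘ ⇑σ) ≤ toLex X ↔
      toLex (fun c => X (toLex (i₂, c))) ≤ toLex (fun c => X (toLex (i₁, c))) := by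
  have hσ' : ∀ k, σ k = toLex (Equiv.swap i₁ i₂ (ofLex k).1, (ofLex k).2) := fun k => hσ (ofLex k).1 (ofLex k).2
  have hinv : ∀ k, σ (σ k) = k := fun k => by
    rw [hσ' k, hσ, Equiv.swap_apply_self]
    rfl
  have hφ : StrictMono fun c : C => (toLex (i₁, c) : R ×ₗ C) := fun c c' h =>
    Prod.Lex.toLex_lt_toLex.2 (Or.inr ⟨rfl, h⟩)
  have hsurj : ∀ k : R ×ₗ C, k < σ k → ∃ c, (toLex (i₁, c) : R ×ₗ C) = k := by
    intro k hk
    rw [hσ' k] at hk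
    refine ⟨(ofLex k).2, ?_⟩
    by_cases h₁ : (ofLex k).1 = i₁
    · rw [← h₁]
      rfl
    by_cases h₂ : (ofLex k).1 = i₂
    · rw [h₂, Equiv.swap_apply_right] at hk
      have hk' := Prod.Lex.toLex_lt_toLex.1 (show toLex ((ofLex k).1, (ofLex k).2) < toLex (i₁, (ofLex k).2)
        from hk)
      rw [h₂] at hk'
      rcases hk' with h | ⟨h, -⟩
      · exact absurd hi (lt_asymm h)
      · exact absurd h.symm (ne_of_lt hi)
    · rw [Equiv.swap_apply_of_ne_of_ne h₁ h₂] at hk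
      exact absurd hk (lt_irrefl _)
  have key := lexLeader_iff_chain hinv hφ hsurj X
  simp only [hσ, Equiv.swap_apply_left] at key
  exact key

/-- **Column chains.** Under the SAME row-major order, let `σ` be the transposition of the columns
`j₁ < j₂` (`σ (r, c) = (r, swap j₁ j₂ c)`). Its lex-leader constraint is equivalent to «column `j₂` ≤_lex
column `j₁`» (columns read top-down): in row-major order the entries of column `j₁` precede their partners
in column `j₂` row by row, so the first difference is decided inside the first differing row. -/
theorem lexLeader_colSwap_iff {j₁ j₂ : C} (hj : j₁ < j₂) {σ : Equiv.Perm (R ×ₗ C)}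
    (hσ : ∀ r c, σ (toLex (r, c)) = toLex (r, Equiv.swap j₁ j₂ c)) (X : R ×ₗ C → α) :
    toLex (X ∘ ⇑σ) ≤ toLex X ↔
      toLex (fun r => X (toLex (r, j₂))) ≤ toLex (fun r => X (toLex (r, j₁))) := by
  have hσ' : ∀ k, σ k = toLex ((ofLex k).1, Equiv.swap j₁ j₂ (ofLex k).2) := fun k => hσ (ofLex k).1 (ofLex k).2
  have hinv : ∀ k, σ (σ k) = k := fun k => by
    rw [hσ' k, hσ, Equiv.swap_apply_self]
    rfl
  have hφ : StrictMono fun r : R => (toLex (r, j₁) : R ×ₗ C) := fun r r' h =>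
    Prod.Lex.toLex_lt_toLex.2 (Or.inl h)
  have hsurj : ∀ k : R ×ₗ C, k < σ k → ∃ r, (toLex (r, j₁) : R ×ₗ C) = k := by
    intro k hk
    rw [hσ' k] at hk
    refine ⟨(ofLex k).1, ?_⟩
    by_cases h₁ : (ofLex k).2 = j₁
    · rw [← h₁]
      rfl
    by_cases h₂ : (ofLex k).2 = j₂
    · rw [h₂, Equiv.swap_apply_right] at hk
      have hk' := Prod.Lex.toLex_lt_toLex.1 (show toLex ((ofLex k).1, (ofLex k).2) < toLex ((ofLex k).1, j₁)
        from hk)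
      rw [h₂] at hk'
      rcases hk' with h | ⟨-, h⟩
      · exact absurd h (lt_irrefl _)
      · exact absurd hj (lt_asymm h)
    · rw [Equiv.swap_apply_of_ne_of_ne h₁ h₂] at hk
      exact absurd hk (lt_irrefl _)
  have key := lexLeader_iff_chain hinv hφ hsurj X
  simp only [hσ, Equiv.swap_apply_left] at key
  exact key

/-- **Double-lex is sound** (Flener–Frisch–Hnich–Kiziltan–Miguel–Pearson–Walsh 2002, in the `≥` orientation;
the row-major lex-leader argument of Crawford–Ginsberg–Luks–Roy 1996 / Shlyakhter 2001). A satisfiable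
constraint `P` on finite matrices `R ×ₗ C → α` that is invariant under swapping any two rows and under
swapping any two columns has a model whose ROWS are lexicographically non-increasing downward AND whose
COLUMNS are lexicographically non-increasing rightward, simultaneously — namely the model that is
lex-maximal in row-major order. -/
theorem exists_model_rows_cols_antitone [Finite R] [Finite C] [Finite α] (P : (R ×ₗ C → α) → Prop)
    (hrow : ∀ (i₁ i₂ : R) (X : R ×ₗ C → α), P X →
      P fun k => X (toLex (Equiv.swap i₁ i₂ (ofLex k).1, (ofLex k).2)))
    (hcol : ∀ (j₁ j₂ : C) (X : R ×ₗ C → α), P X →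
      P fun k => X (toLex ((ofLex k).1, Equiv.swap j₁ j₂ (ofLex k).2)))
    (h : ∃ X, P X) :
    ∃ X, P X ∧
      (∀ i₁ i₂ : R, i₁ < i₂ → toLex (fun c => X (toLex (i₂, c))) ≤ toLex (fun c => X (toLex (i₁, c)))) ∧
      ∀ j₁ j₂ : C, j₁ < j₂ → toLex (fun r => X (toLex (r, j₂))) ≤ toLex (fun r => X (toLex (r, j₁))) := by
  haveI : Finite (R ×ₗ C) := Finite.of_equiv (R × C) toLex
  -- the lex-maximal model in row-major order
  obtain ⟨X₀, hX₀⟩ := h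
  haveI : Nonempty {X // P X} := ⟨⟨X₀, hX₀⟩⟩
  obtain ⟨⟨X, hX⟩, hmax⟩ := Finite.exists_max fun X : {X : R ×ₗ C → α // P X} => toLex X.1
  refine ⟨X, hX, fun i₁ i₂ hi => ?_, fun j₁ j₂ hj => ?_⟩
  · -- the row transposition as a permutation of the variables
    let σ : Equiv.Perm (R ×ₗ C) :=
      (ofLex.trans (Equiv.prodCongr (Equiv.swap i₁ i₂) (Equiv.refl C))).trans toLex
    have hσ : ∀ r c, σ (toLex (r, c)) = toLex (Equiv.swap i₁ i₂ r, c) := fun r c => rfl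
    have hle : toLex (X ∘ ⇑σ) ≤ toLex X := hmax ⟨X ∘ ⇑σ, hrow i₁ i₂ X hX⟩
    exact (lexLeader_rowSwap_iff hi hσ X).1 hle
  · let σ : Equiv.Perm (R ×ₗ C) :=
      (ofLex.trans (Equiv.prodCongr (Equiv.refl R) (Equiv.swap j₁ j₂))).trans toLex
    have hσ : ∀ r c, σ (toLex (r, c)) = toLex (r, Equiv.swap j₁ j₂ c) := fun r c => rfl
    have hle : toLex (X ∘ ⇑σ) ≤ toLex X := hmax ⟨X ∘ ⇑σ, hcol j₁ j₂ X hX⟩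
    exact (lexLeader_colSwap_iff hj hσ X).1 hle

end Matrix

end Summit.Ventures.HSemireg.LexLeaderRowColumn
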